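import Summits.Parity.BatemanHorn.Theses.SelbergLift

/-!
# Refutation of `SelbergLift.SelbergSplit` (stmt-Parity-18416) — refuted-misstated

The route's "exact split" `Ψ₂ = LogPart + Small_ε + Mid_ε + Large_ε` is stated for EVERY real `ε`
(and every `x`).  Its three bands are `s ≤ x^ε`, `x^ε < s ∧ s ≤ x^(1-ε)`, `x^(1-ε) < s`
(`s = min a (m / a)`).  They partition `ℕ` only when `x^ε ≤ x^(1-ε)`; when `x^(1-ε) < x^ε`
(e.g. `ε > 1/2`, `x ≥ 2`) every `s` with `x^(1-ε) < s ≤ x^ε` is counted in BOTH the small and the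
large band, so the right-hand side exceeds the left-hand side by the (positive) doubly counted mass.

Witness: `k = 1`, `f = (fun _ => C 4)` (no system hypothesis is required by the statement), `i = 0`,
`ε = 1`, `x = 2`: `x^ε = 2`, `x^(1-ε) = 1`, the value `m = 4 = 2 · 2` has `s = 2 ∈ (1, 2]`, and the
identity reads `2·(Λ4·log 4 + (log 2)²) = 2·Λ4·log 4 + 2·(log 2)² + 0 + 2·(log 2)²`, i.e.
`(log 2)² = 0` — false.

Repaired statement C′ (believed true, and all the frame `SelbergFrame_of` needs since it only uses
`0 < ε < 1/4`): restrict to `ε ≤ 1/2` (then `x^ε ≤ x^(1-ε)` for every `x ≥ 1`, and `x = 0` is an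
empty sum), i.e.
`∀ k f i (ε : ℝ), ε ≤ 1/2 → ∀ x : ℕ, Ψ₂ = LogPart + Small_ε + Mid_ε + Large_ε` (same four sums);
the witness (`ε = 1`) misses C′.  [folklore]
-/

namespace Summit.Parity.BatemanHorn.Theses.SelbergLift

open scoped BigOperators Topology Manifold Classical MeasureTheory ProbabilityTheory Matrix InnerProductSpace ComplexConjugate ContinuousMap in
open Filter Set Function TopologicalSpace MeasureTheory in
/-- **Record of the dropped route item `SelbergSplit`** = stmt-Parity-18416 (ledger signature verbatim; NOT a route
item): route SelbergLift dropped the item `SelbergSplit` (stmt-18416, refuted-misstated by this file) in a later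
re-cut (replaced by `SelbergSplitR`, rev 4). The declaration `Summit.Parity.BatemanHorn.Theses.SelbergLift.SelbergSplit`
therefore no longer exists in the route file and this accepted module stopped elaborating (stale olean;
buildfix lane 2026-08-19). Re-created here under its original name so the refutation keeps building; the
statement of every previously accepted declaration in this file is unchanged. -/
def SelbergSplit : Prop :=
  ∀ (k : ℕ) (f : Fin k → Polynomial ℤ) (i : Fin k) (ε : ℝ) (x : ℕ), (∑ n ∈ Finset.Icc 1 x, (ArithmeticFunction.vonMangoldt (((f i).eval (n : ℤ)).toNat) * Real.log (((f i).eval (n : ℤ)).toNat) + ∑ a ∈ (((f i).eval (n : ℤ)).toNat).divisors, ArithmeticFunction.vonMangoldt a * ArithmeticFunction.vonMangoldt ((((f i).eval (n : ℤ)).toNat) / a)) * ∏ j ∈ Finset.univ.erase i, ArithmeticFunction.vonMangoldt (((f j).eval (n : ℤ)).toNat)) = (∑ n ∈ Finset.Icc 1 x, ArithmeticFunction.vonMangoldt (((f i).eval (n : ℤ)).toNat) * Real.log (((f i).eval (n : ℤ)).toNat) * ∏ j ∈ Finset.univ.erase i, ArithmeticFunction.vonMangoldt (((f j).eval (n : ℤ)).toNat))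 + (∑ n ∈ Finset.Icc 1 x, (∑ a ∈ (((f i).eval (n : ℤ)).toNat).divisors, if ((min a ((((f i).eval (n : ℤ)).toNat) / a) : ℕ) : ℝ) ≤ (x : ℝ) ^ ε then ArithmeticFunction.vonMangoldt a * ArithmeticFunction.vonMangoldt ((((f i).eval (n : ℤ)).toNat) / a) else 0) * ∏ j ∈ Finset.univ.erase i, ArithmeticFunction.vonMangoldt (((f j).eval (n : ℤ)).toNat)) + (∑ n ∈ Finset.Icc 1 x, (∑ a ∈ (((f i).eval (n : ℤ)).toNat).divisors, if (x : ℝ) ^ ε < ((min a ((((f i).eval (n : ℤ)).toNat) / a) : ℕ) : ℝ) ∧ ((min a ((((f i).eval (n : ℤ)).toNat) / a) : ℕ) : ℝ) ≤ (x : ℝ) ^ (1 - ε) then ArithmeticFunction.vonMangoldt a * ArithmeticFunction.vonMangoldt ((((f i).eval (n : ℤ)).toNat) / a) else 0) * ∏ j ∈ Finset.univ.erase i, ArithmeticFunction.vonMangoldt (((f j).eval (n : ℤ)).toNat)) + (∑ n ∈ Finset.Icc 1 x, (∑ a ∈ (((f i).eval (n : ℤ)).toNat).divisors, if (x : ℝ)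 ^ (1 - ε) < ((min a ((((f i).eval (n : ℤ)).toNat) / a) : ℕ) : ℝ) then ArithmeticFunction.vonMangoldt a * ArithmeticFunction.vonMangoldt ((((f i).eval (n : ℤ)).toNat) / a) else 0) * ∏ j ∈ Finset.univ.erase i, ArithmeticFunction.vonMangoldt (((f j).eval (n : ℤ)).toNat))

end Summit.Parity.BatemanHorn.Theses.SelbergLift

namespace Summit.Parity.BatemanHorn.Theorems

open Summit.Parity.BatemanHorn.Theses.SelbergLift ArithmeticFunction

/-- Refutes `SelbergLift.SelbergSplit` [refuted-misstated]: the split double-counts the band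
`x^(1-ε) < min(a, m/a) ≤ x^ε` whenever `x^(1-ε) < x^ε`; witness `k = 1, f ≡ C 4, i = 0, ε = 1,
x = 2` (doubly counted mass `2·(log 2)² > 0`); repaired: add the side condition `ε ≤ 1/2`
(the frame uses only `0 < ε < 1/4`); the witness misses the repaired statement. [folklore] -/
theorem SelbergLiftSelbergSplit_refuted : ¬ SelbergSplit := by
  intro h
  have E := h 1 (fun _ => Polynomial.C 4) 0 1 2
  have h4 : Int.toNat 4 = 4 := rfl
  have hdiv : Nat.divisors 4 = {1, 2, 4} := by decide
  have hΛ2 : 0 < (Λ 2 : ℝ) := vonMangoldt_pos_iff.mpr Nat.prime_two.isPrimePow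
  simp only [Polynomial.eval_C, Finset.univ_unique, Fin.default_eq_zero, Finset.erase_singleton,
    Finset.prod_empty, mul_one, Finset.sum_const, Nat.card_Icc, Nat.cast_ofNat, Real.rpow_one,
    sub_self, Real.rpow_zero, nsmul_eq_mul, h4, hdiv] at E
  norm_num [Finset.sum_insert, Finset.sum_singleton, Nat.min_def] at E
  nlinarith [mul_pos hΛ2 hΛ2]

end Summit.Parity.BatemanHorn.Theorems
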